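import Summits.QuantumFields.YangMills.Theorems.BalabanUVNodesN11SmallRegFirstStepFails
import Summits.QuantumFields.YangMills.Theorems.BalabanUVNodesN21LocalAveragedRegularity
import Literature.MathematicalPhysics.QuantumFieldTheory.Balaban1983to89.Node00.TkFirstStepRegionVanishing

/-!
# DAG node N11 — THE FIRST (S1ᵀ)₁₃ INSTANCE FAILS AT EVERY STAGE-13 WITNESS, WHATEVER THE (2.12) REGULARITY THRESHOLD: under `TLaw₁₃ θ p 0` EVERY pre-𝐑
# slot `slotT_1(s′)` dies at a generic coarse field that is rough at the centre of every χ₁-cube — the §2 side through p. 256's cut `χreg_0(Ω₁(s′)ᶜ)` on the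
# restricted averaging fibre ([B7] Prop. 1, local), the `(∅, ∅)`-labelled side through [B7] Prop. 2 — while def-T's unity law makes them sum to `T[ρ₀] > 0`

Cell `pub-ymgap`, YM-PLAN Track A (HUMAN RULING D-0062), seat `pub-ymgap-dag-n11-d` (g6; R134 fan-out seat N11 [B14], strategy s2), item K1⁗ `StabilityBAtRecordR13Sep`
= stmt-QuantumFields-20290.  [III] = [Balaban1988Convergent], [B7] = [Balaban1985Averaging].  Sequel of this seat's `…SmallRegFirstStepFails` (g5: the same verdict
at the all-large-field sequence, needing `εreg` in [B7] Prop. 2's range to decide def-R's (2.12) branch) over this seat's Literature-side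
`Node00.TkFirstStepRegionVanishing` (11a's `𝐓_1(s′)` on ANY new sequence dies where `ζ_0(Ω₁ᶜ)` dies on the restricted fibre; the label's cubes lie in `Ω₁ᶜ`; the
`(∅,∅)` label charges only globally small fields; the central coarse plaquette of a cube), seat dag-n21's LOCAL [B7] Prop. 1
(`dist1_plaqHol_avgFun_lt_sharp_of_plaqSmallOn`) and K0b's level-1 unity identity `𝐓ρ₀ = T[ρ₀]` (`Record12ResidualsSlots.trhoOfRecord9_zero_eq_transport`).

WHAT THIS FILE PROVES (0 `sorry`, 0 `def`, standard axioms; `N`-generic).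
* §1 **`sect2Slot_one_ae_zero_on_centralRough₁₃`** — AT EVERY `θ`, for
  EVERY new sequence `s′` of length 1 and every χ₁-cube `□′ ⊆ Ω₁(s′)ᶜ` (cube side `≥ 2((d+5)L + 3)`, `0 < cR·ε₀`, `(((d+4)L)²/4)·cR·ε₀ ≤ δ_N/2`): the §2-form slot
  `𝐓_1(s′) exp A_1(s′)` VANISHES for `dV₁`-a.e. `V₁` having a plaquette based at the central coarse site of `□′` (the block label of the cube's centre,
  `TkFirstStepRegionVanishing` §5) with `dist1 ≥ L²·cRε₀ + C₀(d)(L²·cRε₀)²` — on the restricted fibre over `V₁|_{Ω₁ᶜ}`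
  a `cR·ε₀`-regular configuration would average to a smooth `V₁(∂p′)` there ([B7] Prop. 1, LOCAL: the box of radius `(d+4)L+2` around the centre lies in `□′`).
* §2 **`slotsT_one_ae_zero_of_emptyLabels₁₃`** — for a new sequence reached only by labels `(P₁, Q₁) = (∅, ∅)`, def-T's pre-𝐑 slot VANISHES for a.e. `V₁` with a
  `2β`-rough plaquette (`ε₁η₁² + 8δ₀ ≤ βη₁²`, [B7] guards on `β`): such labels charge only globally `βη₁²`-small fine fields, whose averages are `2β`-smooth (Prop. 2).
* §3 **`fieldMeasure_preimage_centralRough_pos`** — `dU{Ū has a t-rough plaquette at the central coarse site of EVERY χ₁-cube} > 0` for every `t < dist1 g`, `g : SU(N)` (the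
  alternating coarse field has ALL (0,1)-plaquettes of size `dist1 g`; half-guard of the small-loop average; `dU` charges open sets).
* §4 ★★★ **`not_tLaw₁₃_zero`** — AT EVERY Stage-13 `θ` (ζ-unity, `Σ|ζ| ≤ 1`, measurable `U`-sections of the step weights — or §5 `θ.HasResidualsOfRecord`), on every run with
  `0 < K`, `1 ≤ M`, `1 ≤ M₂`, cube side `2((d+5)L+3) ≤ sideχ`, the two small parameters `cR·ε₀` and `β` guarded as above, and `SU(N)` non-trivial at the larger of the two
  thresholds: **`¬ TLaw₁₃ F N θ p 0`**.  NO hypothesis on `θ.ν.εreg`, NO branch of def-R's `UminOfRecord`: the tree's typed first 𝐓-step law is unsatisfiable as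
  stated.  Mechanism: at a generic central-rough `V₁` every summand of `𝐓ρ₀(V₁) = Σ_{s′} χ₁(s′)(V₁)·slotT_1(s′)(V₁)` vanishes (§1 for sequences with a non-trivial label,
  §2 for the others, AC-free fibre lemma), yet the sum IS `T[ρ₀](V₁) = avgDensity(V₁)·∫ρ₀ dκ` (K0b), so `avgDensity = 0` a.e. on a set of positive `dŪ`-mass (§3).
* §5 `…_of_hasResidualsOfRecord`, `…_su2_of_hasResidualsOfRecord` (n07-e's `su2_dist1_surj`), `not_s1T₁₃_su2_of_hasResidualsOfRecord` (the (S1ᵀ)₁₃ conjunct of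
  K1⁗'s rung 1 is FALSE there: `SLaw₁₃ θ p 0` is def-T's theorem).

READING (count-neutral; nothing of Bałaban asserted or refuted).  The desk's ME #15 verdict («typed-statement defect at the 12a∕def-T junction: the 𝐓-image carries
`χreg_0`, the step weights do not») is now a kernel fact at EVERY witness of the record, including the witness of record `theta13LiveOfRecord` (`εreg = 1`, sequel
file): K1⁗'s N11 conjunct cannot be supplied through the knit's `hT` at any `θ`; the cure is the re-type of the junction (12a∕def-T), not a choice of witness or of
`εreg`.  K1⁗ (an `∃ θ` statement) is NOT thereby refuted; N11 ∕ K1⁗ NOT discharged; counts unmoved (typed 28∕28 · discharged 5∕28).  One finite four-torus at fixed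
`ε = L^{−K}`; NOT ℝ⁴ ∕ OS ∕ mass gap ∕ Clay.  Sources: [III] Theorem p.245, (2.10) p.256, (2.16)–(2.18) p.257, (2.20)–(2.22) p.258, (3.1)–(3.5) pp.264–265, (3.16) p.268,
(3.24)–(3.25) p.270; [B7] (9)–(10) p.19, Prop. 1 (51) pp.25–26, Prop. 2 (52)–(54) p.26; [Balaban1987RG1] (0.1)–(0.4) pp.251–253.
-/

noncomputable section

open MeasureTheory ProbabilityTheory
open scoped BigOperators Matrix.Norms.L2Operator ENNReal NNReal

namespace Summit.QuantumFields.YangMills.Theorems.BalabanUVNodesN11FirstStepFailsAtEveryWitness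

open Literature.MathematicalPhysics.QuantumFieldTheory.Balaban1983to89 T4Continuum Node00 Node00.Tk DagBinding
open Literature.MathematicalPhysics.QuantumFieldTheory.Balaban1983to89.T4AveragingDisintegration
  (transportK kernelTransport avgKernel avgDensity)
open Literature.MathematicalPhysics.QuantumFieldTheory.Balaban1983to89.ExpMeanLog (deltaSU)
open B15DeterminingSets (pts)
open B14.Eq218Concrete (Seq)
open BlockAveraging (avgFun)
open ExpMeanLog (expMeanLogSU expMeanLogSUc)
open BlockAveragingSection (faceSec)
open B10Eq42TorusConstraint (bondsIn mem_bondsIn_iff)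
open B12ContinuousTransportInvarianceOn (continuous_dist1_SU continuous_plaqHol_SU)
open B12ContinuousTransportInvariance (isOpenPosMeasure_fieldMeasure_SU)
open GaugeField (plaqHol)
open B15Eq112TorusCover (cover)
open Summit.QuantumFields.YangMills.Theorems.BalabanUVNodesN11AllLargeFieldLabel
  (sideD_pos sideχ_pos transportOfRecord_rhoZero_eq_zero_iff fieldMeasure_preimage_eq_zero_of_avgDensity_ae_zero)
open Summit.QuantumFields.YangMills.BalabanUVNodes.N07Thm1ScaledInterfaceInstance (su2_dist1_surj)
open Summit.QuantumFields.YangMills.BalabanUVNodes.N20LCSAvgDominationRegion (boxRegion mem_boxRegion)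
open Summit.QuantumFields.YangMills.Theorems.N21LocalAveragedRegularity (dist1_plaqHol_avgFun_lt_sharp_of_plaqSmallOn)
open Summit.QuantumFields.YangMills.Theorems.N21AveragedDatumRegularity (plaqSmall_iter_avOfRecord_level)

variable {F : T4Family} {N : ℕ} [NeZero N]

/-! ## §1. The §2-form slot on ANY new sequence dies on the central-rough coarse fields of a cube in `Ω₁(s′)ᶜ` -/

section Sect2Side

variable (ν : Stage7Numerics) (p : B12.RunParams) (g : ℕ → ℝ)

/-- `2 ≤ d` on the family's tori (`d = 4`). [cite: Balaban1987RG1, (0.1) p.251 (bookkeeping)] -/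
theorem two_le_d : 2 ≤ (F.P p.K).d := by rw [T4Family.P_d]; norm_num

/-- The box radius of [B7] Prop. 1's locality, `(d+4)L + 2`, is at least `2L`. [cite: Balaban1985Averaging, Prop. 1 p.25 (bookkeeping)] -/
theorem two_mul_L_le_boxRadius : 2 * (F.P p.K).L ≤ ((F.P p.K).d + 4) * (F.P p.K).L + 2 := by nlinarith [(F.P p.K).L_pos, Nat.zero_le (F.P p.K).d]

variable {ν p g}

/-- The four bonds of a level-1 plaquette based at the CENTRAL COARSE SITE of the χ₁-cube `□′` (the block label of the cube's centre) are level-1 bonds IN `□′`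
(cube side `≥ 2(3L + 1)`). [cite: Balaban1985Variational, (3) p.278; Balaban1988Convergent, (2.17) p.257 (bookkeeping)] -/
theorem bonds_mem_bondsIn_of_src_eq_central (hS : 2 * (2 * (F.P p.K).L + (F.P p.K).L + 1) ≤ sideχ F ν p g 0) (c : Iχ F ν p g 0)
    (q : Plaq (F.P p.K) 1) (hq : q.src = blockOf (cover (F.P p.K) (fun i => ((sideχ F ν p g 0 : ℕ) : ℤ) * (c : B14DomainGeom.Pt (F.P p.K).d) i + ((sideχ F ν p g 0 / 2 : ℕ) : ℤ)))) :
    (⟨q.src, q.μ⟩ : PBond (F.P p.K) 1) ∈ bondsIn 1 (cubeχ F ν p g 0 c) ∧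
    (⟨q.src.shift q.μ, q.ν⟩ : PBond (F.P p.K) 1) ∈ bondsIn 1 (cubeχ F ν p g 0 c) ∧
    (⟨q.src.shift q.ν, q.μ⟩ : PBond (F.P p.K) 1) ∈ bondsIn 1 (cubeχ F ν p g 0 c) ∧
    (⟨q.src, q.ν⟩ : PBond (F.P p.K) 1) ∈ bondsIn 1 (cubeχ F ν p g 0 c) := by
  have hmK : 1 ≤ (F.P p.K).m + (F.P p.K).K := by have := F.hm; rw [T4Family.P_m]; omega
  refine ⟨?_, ?_, ?_, ?_⟩
  · exact mem_bondsIn_of_corner_centralSite hmK hS (Or.inl hq)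
  · exact mem_bondsIn_of_corner_centralSite hmK hS (Or.inr ⟨q.μ, by rw [hq]⟩)
  · exact mem_bondsIn_of_corner_centralSite hmK hS (Or.inr ⟨q.ν, by rw [hq]⟩)
  · exact mem_bondsIn_of_corner_centralSite hmK hS (Or.inl hq)

/-- `bondsIn` is monotone in the region. [cite: Balaban1985Variational, (3) p.278 (bookkeeping)] -/
theorem bondsIn_mono {P : Params} {j : ℕ} {X Y : Set (Site P 0)} (h : X ⊆ Y) : bondsIn j X ⊆ bondsIn j Y :=
  fun _ hb => ⟨h hb.1, h hb.2⟩

/-- **ON THE RESTRICTED FIBRE OVER A CENTRAL-ROUGH `V₁` NO CONFIGURATION IS `a`-REGULAR ON `Ω₁(s′)ᶜ ⊇ □′`** (first step; `0 < a`, `(((d+4)L)²/4)·a ≤ δ_N/2`, cube side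
`≥ 2((d+5)L + 3)`): if the fine variables `y` on the bonds in `Ω₁ᶜ` average (restricted averaging of record) to `V₁` on the level-1 bonds in `Ω₁ᶜ`, and a plaquette `p′`
of `V₁` based at the central coarse site of `□′` has `dist1 ≥ L²a + 143((((d+4)L)²/4)·a)²`, then `y` (extended by `1`) is NOT `a`-plaquette-small on the plaquettes
touching `Ω₁ᶜ` — otherwise [B7] Prop. 1 (LOCAL, box of radius `(d+4)L+2` around the centre, inside `□′`) would make that plaquette variable smooth.
[cite: Balaban1985Averaging, Prop. 1 (51) pp.25–26; Balaban1988Convergent, (2.10) p.256, (2.21) p.258] -/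
theorem not_plaqSmallOn_fibre_of_centralRough {M : ℕ} {a T : ℝ} (ha : 0 < a)
    (has : ((((F.P p.K).d + 4) * (F.P p.K).L : ℕ) : ℝ) ^ 2 / 4 * a ≤ deltaSU (Fin N) / 2)
    (hT : ((F.P p.K).L : ℝ) ^ 2 * a + 143 * (((((F.P p.K).d + 4) * (F.P p.K).L : ℕ) : ℝ) ^ 2 / 4 * a) ^ 2 ≤ T)
    (hS : 2 * ((((F.P p.K).d + 4) * (F.P p.K).L + 2) + (F.P p.K).L + 1) ≤ sideχ F ν p g 0)
    (s : SeqOfRecord F ν M g p.K 1) {c : Iχ F ν p g 0} (hc : cubeχ F ν p g 0 c ⊆ (s.Ω 1)ᶜ)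
    {V1 : GaugeField (F.P p.K) 1 (SU N)} {q : Plaq (F.P p.K) 1} (hq : q.src = blockOf (cover (F.P p.K) (fun i => ((sideχ F ν p g 0 : ℕ) : ℤ) * (c : B14DomainGeom.Pt (F.P p.K).d) i + ((sideχ F ν p g 0 / 2 : ℕ) : ℤ))))
    (hrough : T ≤ dist1 (plaqHol V1 q))
    (y : ↥(Set.toFinite (bondsIn 0 (s.Ω 1)ᶜ)).toFinset → SU N) (hy : ∀ b : ↥(Set.toFinite (bondsIn 1 (s.Ω 1)ᶜ)).toFinset, avgRestrOfRecord F N p.K 0 (Set.toFinite (bondsIn 0 (s.Ω 1)ᶜ)).toFinset (Set.toFinite (bondsIn 1 (s.Ω 1)ᶜ)).toFinset y b = V1 b) :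
    ¬ PlaqSmallOn (B8Eq17ClassAkV1.plaqsOf (pts 0 (s.Ω 1)ᶜ)) a (Function.updateFinset (fun _ => 1) (Set.toFinite (bondsIn 0 (s.Ω 1)ᶜ)).toFinset y) := by
  classical
  intro hreg
  have hmK : 1 ≤ (F.P p.K).m + (F.P p.K).K := by have := F.hm; rw [T4Family.P_m]; omega
  set U : GaugeField (F.P p.K) 0 (SU N) := Function.updateFinset (fun _ => 1) (Set.toFinite (bondsIn 0 (s.Ω 1)ᶜ)).toFinset y with hU
  -- the box of [B7] Prop. 1 around the centre lies in the cube, hence in `Ω₁ᶜ`: `U` is `a`-small on it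
  have hbox : PlaqSmallOn (↑(boxRegion (emb q.src) (((F.P p.K).d + 4) * (F.P p.K).L + 2)) : Set (Plaq (F.P p.K) 0)) a U := by
    intro q' hq'
    refine hreg q' (Or.inl ?_)
    rw [B15DeterminingSets.mem_pts]
    show q'.src ∈ (s.Ω 1)ᶜ
    refine hc (mem_cubeEnl_of_near_emb_centralSite hmK hS fun i => ?_)
    obtain ⟨e, he, h⟩ := mem_boxRegion.1 (Finset.mem_coe.1 hq') i
    exact ⟨e, he, by rw [h, hq]⟩
  have hlt := dist1_plaqHol_avgFun_lt_sharp_of_plaqSmallOn (n := Fin N) ha has q hbox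
  -- on the fibre the averaged plaquette IS `V₁(∂p′)` (the four bonds of the plaquette are image bonds)
  have hS3 : 2 * (2 * (F.P p.K).L + (F.P p.K).L + 1) ≤ sideχ F ν p g 0 := by
    have := two_mul_L_le_boxRadius (F := F) p; omega
  obtain ⟨h1, h2, h3, h4⟩ := bonds_mem_bondsIn_of_src_eq_central hS3 c q hq
  have hmem : ∀ {b : PBond (F.P p.K) 1}, b ∈ bondsIn 1 (cubeχ F ν p g 0 c) → b ∈ (Set.toFinite (bondsIn 1 (s.Ω 1)ᶜ)).toFinset := fun hb =>
    (Set.Finite.mem_toFinset _).2 (bondsIn_mono hc hb)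
  have hval : ∀ {b : PBond (F.P p.K) 1} (hb : b ∈ bondsIn 1 (cubeχ F ν p g 0 c)), avgFun (expMeanLogSU (n := Fin N)) U b = V1 b :=
    fun {b} hb => hy ⟨b, hmem hb⟩
  have heq : plaqHol (avgFun (expMeanLogSU (n := Fin N)) U) q = plaqHol V1 q := by
    unfold GaugeField.plaqHol
    rw [hval h1, hval h2, hval h3, hval h4]
  rw [heq] at hlt
  linarith

variable (θ : Stage13Params F N) (p : B12.RunParams)

/-- **THE §2-FORM SLOT `𝐓_1(s′) exp A_1(s′)` OF RECORD VANISHES a.e. ON THE CENTRAL-ROUGH COARSE FIELDS OF A CUBE IN `Ω₁(s′)ᶜ` — EVERY `θ`, EVERY new sequence**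
(any residual `Zt`, any term values `t`, constant `E₁`, background map `U`; `0 < cR·ε₀`, the [B7] Prop. 1 guard on `cR·ε₀`, cube side `≥ 2((d+5)L+3)`): for `□′ ⊆ Ω₁(s′)ᶜ`
and every plaquette `p′` of `T^{(1)}` based at the central coarse site of `□′`, `sect2Slot … s′ t E U V₁ = 0` for `dV₁`-a.e. `V₁` with
`dist1 (V₁(∂p′)) ≥ L²·cRε₀ + C₀(d)(L²·cRε₀)²` — p. 256's `χreg_0(Ω₁ᶜ)` kills the whole restricted fibre.
[cite: Balaban1988Convergent, (2.10) p.256, (2.18) p.257, (2.21) p.258, (3.25) p.270; Balaban1985Averaging, Prop. 1 (51) pp.25–26] -/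
theorem sect2Slot_one_ae_zero_on_centralRough₁₃ {T : ℝ} (ha : 0 < θ.s2.cR * epsOfRecord θ.ν (gOfRecord₁₃ F N θ p) 0)
    (has : ((((F.P p.K).d + 4) * (F.P p.K).L : ℕ) : ℝ) ^ 2 / 4 * (θ.s2.cR * epsOfRecord θ.ν (gOfRecord₁₃ F N θ p) 0) ≤ deltaSU (Fin N) / 2)
    (hT : ((F.P p.K).L : ℝ) ^ 2 * (θ.s2.cR * epsOfRecord θ.ν (gOfRecord₁₃ F N θ p) 0) +
      143 * (((((F.P p.K).d + 4) * (F.P p.K).L : ℕ) : ℝ) ^ 2 / 4 * (θ.s2.cR * epsOfRecord θ.ν (gOfRecord₁₃ F N θ p) 0)) ^ 2 ≤ T)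
    (hS : 2 * ((((F.P p.K).d + 4) * (F.P p.K).L + 2) + (F.P p.K).L + 1) ≤ sideχ F θ.ν p (gOfRecord₁₃ F N θ p) 0)
    (s : SeqOfRecord F θ.ν θ.τ9.M (gOfRecord₁₃ F N θ p) p.K 1) {c : Iχ F θ.ν p (gOfRecord₁₃ F N θ p) 0}
    (hc : cubeχ F θ.ν p (gOfRecord₁₃ F N θ p) 0 c ⊆ (s.Ω 1)ᶜ) {q : Plaq (F.P p.K) 1}
    (hq : q.src = blockOf (cover (F.P p.K) (fun i => ((sideχ F θ.ν p (gOfRecord₁₃ F N θ p) 0 : ℕ) : ℤ) * (c : B14DomainGeom.Pt (F.P p.K).d) i + ((sideχ F θ.ν p (gOfRecord₁₃ F N θ p) 0 / 2 : ℕ) : ℤ))))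
    (t : Sect2.TermValues (F.P p.K) (MatA N) (FluctV N) θ.τ9.M) (Ek : ℝ) (U : BgMap F N p.K) :
    ∀ᵐ V1 ∂fieldMeasure (F.P p.K) 1 (SU N), T ≤ dist1 (plaqHol V1 q) →
      sect2Slot F N (FluctV N) p.K (settingOfRecord₁₃ F N θ p) (θ.Rz p.K) (WtOfRecord₁₃ F N θ p) s t Ek U V1 = 0 := by
  unfold sect2Slot
  rw [WtOfRecord₁₃_eq]
  exact TkOfRecord_one_ae_zero_of_not_regular_fibre θ.ν θ.τ9.M θ.A₁ θ.s2.cR p (gOfRecord₁₃ F N θ p) (θ.Zt p.K) s _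
    fun V1 hV1 y hy => not_plaqSmallOn_fibre_of_centralRough ha has hT hS s hc hq hV1 y hy

end Sect2Side

/-! ## §2. def-T's side: a sequence reached only by `(∅, ∅)`-labels has a vanishing pre-𝐑 slot on the rough coarse fields -/

section EmptySide

variable (θ : Stage13Params F N) (p : B12.RunParams)

/-- **`a(∅)(Ū)·b(∅,∅)(U,Ū) = 0` WHEN `Ū` HAS A `2β`-ROUGH PLAQUETTE** (first step, on the graph of the averaging of record; `0 <` the χ-side, `ε₁η₁² + 4·(2δ₀) ≤ βη₁²`,
[B7] guards on `β`): the `(∅,∅)` label charges only globally `βη₁²`-small fine fields (`TkFirstStepRegionVanishing`), whose one-step averages are `2β`-small ([B7] Prop. 2).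
[cite: Balaban1988Convergent, (3.2)–(3.5) p.265; Balaban1985Averaging, Prop. 2 (52)–(54) p.26] -/
theorem aWeight_mul_bWeight_empty_eq_zero_of_avg_rough (hχ : 0 < sideχ F θ.ν p (gOfRecord₁₃ F N θ p) 0)
    (s₀ : SeqOfRecord F θ.ν θ.τ9.M (gOfRecord₁₃ F N θ p) p.K 0) {β : ℝ} (hβ : 0 < β)
    (hβ3 : (143 * (((((F.P p.K).d + 4 : ℕ) : ℝ)) ^ 2 / 4) ^ 2) * β ≤ 1 / 3)
    (hβ2 : 2 * β ≤ 2 * deltaSU (Fin N) / ((((F.P p.K).d + 4) * (F.P p.K).L : ℕ) : ℝ) ^ 2)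
    (hβε : epsOfRecord θ.ν (gOfRecord₁₃ F N θ p) 1 * (F.P p.K).eta 1 ^ 2 + 4 * (2 * deltaOfRecord θ.ν (gOfRecord₁₃ F N θ p) 0 θ.A₁) ≤
      β * (F.P p.K).eta 1 ^ 2)
    (U : GaugeField (F.P p.K) 0 (SU N)) {q : Plaq (F.P p.K) 1} (hq : 2 * β ≤ dist1 (plaqHol ((avOfRecord F N p.K 0).avg U) q)) :
    aWeight F N θ.ν θ.τ9.M p (gOfRecord₁₃ F N θ p) 0 s₀ ∅ ((avOfRecord F N p.K 0).avg U) *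
      bWeight F N θ.ν θ.τ9.M p (gOfRecord₁₃ F N θ p) 0 θ.A₁ s₀ ∅ ∅ U ((avOfRecord F N p.K 0).avg U) = 0 := by
  by_contra h
  have hsmall := plaqSmall_of_aWeight_mul_bWeight_empty_ne_zero F N θ.ν θ.τ9.M θ.A₁ p (gOfRecord₁₃ F N θ p) s₀ hχ U _ h
  have hβU : PlaqSmall (β * (F.P p.K).eta 1 ^ 2) U := fun q' => (hsmall q').trans_le hβε
  have havg := plaqSmall_iter_avOfRecord_level (F := F) (N := N) p.K 1 hβ hβ3 hβ2 hβU (le_refl 1)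
  have hL : ((F.P p.K).L : ℝ) ^ 1 * (F.P p.K).eta 1 = 1 := by
    rw [Params.eta, pow_one, pow_one, mul_inv_cancel₀ (by exact_mod_cast (F.P p.K).L_pos.ne')]
  have hq' := havg q
  rw [hL, one_pow, mul_one] at hq'
  exact absurd hq' (not_lt.2 hq)

open Classical in
/-- **A NEW SEQUENCE REACHED ONLY BY `(∅,∅)`-LABELS HAS VANISHING PRE-𝐑 SLOT a.e. ON THE `2β`-ROUGH COARSE FIELDS** (any `θ`, any `ζ`; `0 < K`, `0 <` the χ-side, the `β`
guards): def-T's `slotT_1(s′)(V₁) = T[w(s′)(·,V₁)ρ₀](V₁)` and `w(s′)(U, Ū) = 0` whenever `Ū` has a `2β`-rough plaquette — the AC-free fibre lemma of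
`TkFirstStepRegionVanishing` does the rest. [cite: Balaban1988Convergent, (3.1) p.264, (3.5) p.265, (3.25) p.270; Balaban1985Averaging, (10) p.19, Prop. 2 (54) p.26] -/
theorem slotsT_one_ae_zero_of_emptyLabels₁₃ (hχ : 0 < sideχ F θ.ν p (gOfRecord₁₃ F N θ p) 0) {β : ℝ} (hβ : 0 < β)
    (hβ3 : (143 * (((((F.P p.K).d + 4 : ℕ) : ℝ)) ^ 2 / 4) ^ 2) * β ≤ 1 / 3)
    (hβ2 : 2 * β ≤ 2 * deltaSU (Fin N) / ((((F.P p.K).d + 4) * (F.P p.K).L : ℕ) : ℝ) ^ 2)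
    (hβε : epsOfRecord θ.ν (gOfRecord₁₃ F N θ p) 1 * (F.P p.K).eta 1 ^ 2 + 4 * (2 * deltaOfRecord θ.ν (gOfRecord₁₃ F N θ p) 0 θ.A₁) ≤
      β * (F.P p.K).eta 1 ^ 2) :
    ∀ᵐ V1 ∂fieldMeasure (F.P p.K) 1 (SU N), ∀ (s : SeqOfRecord F θ.ν θ.τ9.M (gOfRecord₁₃ F N θ p) p.K 1) (q : Plaq (F.P p.K) 1),
      (∀ t : LbOfRecord F θ.ν p (gOfRecord₁₃ F N θ p) 0, σOfRecord F θ.ν θ.τ9.M p (gOfRecord₁₃ F N θ p) 0 s.init t = s → t.1 = ∅ ∧ t.2.1 = ∅) →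
      2 * β ≤ dist1 (plaqHol V1 q) →
        slotsTOfRecord F N θ.ν θ.τ9 (EOfRecord₁₃ F N θ) (wOfRecord₉ F N θ.toStage9Params) θ.ppSel p (gOfRecord₁₃ F N θ p) 1 s V1 = 0 := by
  have hgood := kernelTransport_ae_forall_eq_zero_of_fibre (fieldMeasure (F.P p.K) 0 (SU N)) (fieldMeasure (F.P p.K) 1 (SU N))
    (avOfRecord_measurable F N p.K 0)
  filter_upwards [hgood] with V1 hV1 s q hlab hq
  rw [slotsTOfRecord_one_apply]
  refine hV1 _ fun U hU => ?_
  have hab := aWeight_mul_bWeight_empty_eq_zero_of_avg_rough θ p hχ s.init hβ hβ3 hβ2 hβε U (q := q) (by rw [hU]; exact hq)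
  rw [hU] at hab
  show wOfRecord F N θ.ν θ.τ9.M θ.A₁ θ.ζ p (gOfRecord₁₃ F N θ p) 0 s U V1 * _ = 0
  rw [wOfRecord_eq_zero_of_forall_label_empty F N θ.ν θ.τ9.M θ.A₁ p (gOfRecord₁₃ F N θ p) 0 θ.ζ s hlab U V1 hab, zero_mul]

end EmptySide

/-! ## §3. Positivity: the coarse fields rough at the centre of EVERY χ₁-cube have a preimage of positive Haar measure -/

section Positivity

variable (F N)
variable (ν : Stage7Numerics) (p : B12.RunParams) (g : ℕ → ℝ)

/-- The strict central-roughness event «near the centre of EVERY χ₁-cube some level-1 plaquette based at the central coarse site is `t`-rough» is open (finitely many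
continuous plaquette conditions). [cite: Balaban1985Averaging, (9) p.19 (bookkeeping)] -/
theorem isOpen_centralRough_lt (t : ℝ) :
    IsOpen {V1 : GaugeField (F.P p.K) 1 (SU N) | ∀ c : Iχ F ν p g 0, ∃ q : Plaq (F.P p.K) 1,
      q.src = blockOf (cover (F.P p.K) (fun i => ((sideχ F ν p g 0 : ℕ) : ℤ) * (c : B14DomainGeom.Pt (F.P p.K).d) i + ((sideχ F ν p g 0 / 2 : ℕ) : ℤ))) ∧ t < dist1 (plaqHol V1 q)} := by
  rw [show {V1 : GaugeField (F.P p.K) 1 (SU N) | ∀ c : Iχ F ν p g 0, ∃ q : Plaq (F.P p.K) 1,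
      q.src = blockOf (cover (F.P p.K) (fun i => ((sideχ F ν p g 0 : ℕ) : ℤ) * (c : B14DomainGeom.Pt (F.P p.K).d) i + ((sideχ F ν p g 0 / 2 : ℕ) : ℤ))) ∧ t < dist1 (plaqHol V1 q)} =
      ⋂ c : Iχ F ν p g 0, ⋃ q : Plaq (F.P p.K) 1, {V1 | q.src = blockOf (cover (F.P p.K) (fun i => ((sideχ F ν p g 0 : ℕ) : ℤ) * (c : B14DomainGeom.Pt (F.P p.K).d) i + ((sideχ F ν p g 0 / 2 : ℕ) : ℤ))) ∧ t < dist1 (plaqHol V1 q)} by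
    ext V1; simp]
  refine isOpen_iInter_of_finite fun c => isOpen_iUnion fun q => ?_
  by_cases hq : q.src = blockOf (cover (F.P p.K) (fun i => ((sideχ F ν p g 0 : ℕ) : ℤ) * (c : B14DomainGeom.Pt (F.P p.K).d) i + ((sideχ F ν p g 0 / 2 : ℕ) : ℤ)))
  · simp only [hq, true_and]
    exact isOpen_lt continuous_const ((continuous_dist1_SU (N := N)).comp (continuous_plaqHol_SU (N := N) _))
  · simp only [hq, false_and, Set.setOf_false, isOpen_empty]

/-- The central-roughness event is measurable. [cite: Balaban1985Averaging, (9) p.19 (bookkeeping)] -/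
theorem measurableSet_centralRough (t : ℝ) :
    MeasurableSet {V1 : GaugeField (F.P p.K) 1 (SU N) | ∀ c : Iχ F ν p g 0, ∃ q : Plaq (F.P p.K) 1,
      q.src = blockOf (cover (F.P p.K) (fun i => ((sideχ F ν p g 0 : ℕ) : ℤ) * (c : B14DomainGeom.Pt (F.P p.K).d) i + ((sideχ F ν p g 0 / 2 : ℕ) : ℤ))) ∧ t ≤ dist1 (plaqHol V1 q)} := by
  rw [show {V1 : GaugeField (F.P p.K) 1 (SU N) | ∀ c : Iχ F ν p g 0, ∃ q : Plaq (F.P p.K) 1,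
      q.src = blockOf (cover (F.P p.K) (fun i => ((sideχ F ν p g 0 : ℕ) : ℤ) * (c : B14DomainGeom.Pt (F.P p.K).d) i + ((sideχ F ν p g 0 / 2 : ℕ) : ℤ))) ∧ t ≤ dist1 (plaqHol V1 q)} =
      ⋂ c : Iχ F ν p g 0, ⋃ q : Plaq (F.P p.K) 1, {V1 | q.src = blockOf (cover (F.P p.K) (fun i => ((sideχ F ν p g 0 : ℕ) : ℤ) * (c : B14DomainGeom.Pt (F.P p.K).d) i + ((sideχ F ν p g 0 / 2 : ℕ) : ℤ))) ∧ t ≤ dist1 (plaqHol V1 q)} by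
    ext V1; simp]
  refine MeasurableSet.iInter fun c => MeasurableSet.iUnion fun q => ?_
  by_cases hq : q.src = blockOf (cover (F.P p.K) (fun i => ((sideχ F ν p g 0 : ℕ) : ℤ) * (c : B14DomainGeom.Pt (F.P p.K).d) i + ((sideχ F ν p g 0 / 2 : ℕ) : ℤ)))
  · simp only [hq, true_and]
    exact measurableSet_le measurable_const (RegularGaugeGroup.measurable_dist1.comp (Missing.measurable_plaqHol _))
  · simp only [hq, false_and, Set.setOf_false, MeasurableSet.empty]

/-- **THE FINE FIELDS WHOSE AVERAGE IS `t`-ROUGH AT THE CENTRE OF EVERY χ₁-CUBE HAVE POSITIVE HAAR MEASURE** (`t < dist1 g`, `g : SU(N)`): the event contains the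
pullback of an OPEN neighbourhood of the alternating coarse field (ALL of whose (0,1)-plaquettes have size `dist1 g` — in particular the one based at each central
coarse site) under the continuous modification of the averaging of record on the half-guard of the small-loop average, through the face section; `dU` charges open
sets. [cite: Balaban1987RG1, (0.3)–(0.4) pp.252–253; Balaban1985Averaging, (9)–(10) p.19; Balaban1988Convergent, (2.17) p.257] -/
theorem fieldMeasure_preimage_centralRough_pos (g₀ : SU N) {t : ℝ} (ht : t < dist1 g₀) :
    0 < fieldMeasure (F.P p.K) 0 (SU N)
      ((avOfRecord F N p.K 0).avg ⁻¹'
        {V1 : GaugeField (F.P p.K) 1 (SU N) | ∀ c : Iχ F ν p g 0, ∃ q : Plaq (F.P p.K) 1,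
          q.src = blockOf (cover (F.P p.K) (fun i => ((sideχ F ν p g 0 : ℕ) : ℤ) * (c : B14DomainGeom.Pt (F.P p.K).d) i + ((sideχ F ν p g 0 / 2 : ℕ) : ℤ))) ∧ t ≤ dist1 (plaqHol V1 q)}) := by
  haveI := isOpenPosMeasure_fieldMeasure_SU (N := N) (F.P p.K) 0
  have hmK' : 0 + 1 ≤ (F.P p.K).m + (F.P p.K).K := by have := F.hm; rw [T4Family.P_m]; omega
  have hd : 2 ≤ (F.P p.K).d := two_le_d (F := F) p
  have h01 : (⟨0, by omega⟩ : Fin (F.P p.K).d) < ⟨1, by omega⟩ := Fin.mk_lt_mk.2 Nat.zero_lt_one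
  set O : Set (GaugeField (F.P p.K) 0 (SU N)) :=
    {U | ∀ (b : PBond (F.P p.K) (0 + 1)) (i : BlockAveraging.Idx (F.P p.K)), dist1 (BlockAveraging.loopHol U b i) < (expMeanLogSU (n := Fin N)).δ / 2} ∩
      avgFun (expMeanLogSUc (n := Fin N)) ⁻¹'
        {V1 : GaugeField (F.P p.K) 1 (SU N) | ∀ c : Iχ F ν p g 0, ∃ q : Plaq (F.P p.K) 1,
          q.src = blockOf (cover (F.P p.K) (fun i => ((sideχ F ν p g 0 : ℕ) : ℤ) * (c : B14DomainGeom.Pt (F.P p.K).d) i + ((sideχ F ν p g 0 / 2 : ℕ) : ℤ))) ∧ t < dist1 (plaqHol V1 q)} with hO_def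
  have hO : IsOpen O :=
    isOpen_halfSmall.inter ((isOpen_centralRough_lt F N ν p g t).preimage BlockAveraging.continuous_avgFun_expMeanLogSUc)
  have hsub : O ⊆ (avOfRecord F N p.K 0).avg ⁻¹'
      {V1 : GaugeField (F.P p.K) 1 (SU N) | ∀ c : Iχ F ν p g 0, ∃ q : Plaq (F.P p.K) 1,
          q.src = blockOf (cover (F.P p.K) (fun i => ((sideχ F ν p g 0 : ℕ) : ℤ) * (c : B14DomainGeom.Pt (F.P p.K).d) i + ((sideχ F ν p g 0 / 2 : ℕ) : ℤ))) ∧ t ≤ dist1 (plaqHol V1 q)} := by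
    rintro U ⟨hhalf, hcoarse⟩
    rw [Set.mem_preimage, avOfRecord_avg_eq_SUc_of_halfSmall F p.K 0 U hhalf, Set.mem_setOf_eq]
    intro c
    obtain ⟨q, hq, hlt⟩ := hcoarse c
    exact ⟨q, hq, hlt.le⟩
  obtain ⟨V₀, hV₀, -⟩ := exists_coarse_faceSec_corner_dist1_eq (P := F.P p.K) (j := 0) (G := SU N) hd hmK' g₀
  have hmem : faceSec V₀ ∈ O := by
    refine ⟨halfSmall_faceSec hmK' V₀, ?_⟩
    rw [Set.mem_preimage, avgFun_expMeanLogSUc_faceSec hmK' V₀, Set.mem_setOf_eq]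
    intro c
    refine ⟨⟨blockOf (cover (F.P p.K) (fun i => ((sideχ F ν p g 0 : ℕ) : ℤ) * (c : B14DomainGeom.Pt (F.P p.K).d) i + ((sideχ F ν p g 0 / 2 : ℕ) : ℤ))), _, _, h01⟩, rfl, ?_⟩
    rw [hV₀ _ h01]
    exact ht
  exact (hO.measure_pos (fieldMeasure (F.P p.K) 0 (SU N)) ⟨_, hmem⟩).trans_le (measure_mono hsub)

end Positivity

end Summit.QuantumFields.YangMills.Theorems.BalabanUVNodesN11FirstStepFailsAtEveryWitness

end
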